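import Summits.Ventures.DiscreteObjects.PP12.OrderElevenTriangleKernel
import Summits.Ventures.DiscreteObjects.PP12.OrderElevenTriangleRowCode

/-!
# PP(12), order-11 cell, Case B (`NoTriangleData12`): SOUNDNESS of the partition walker (designs g23)
Framing: lottery ticket; floor = certified bounds/negative ranges.

Cell pub-namedobj (venture DiscreteObjects), target (M). `partsEnum = pgo 22 2044 0 2 1 1 []` (`OrderElevenTriangleKernel`) enumerates block partitions of
`{1,…,10}` whose internal differences are pairwise distinct and exhaust `Z₁₁ ∖ {0}`. Here: for data `D` and a free line orbit `s` satisfying (K0) and (D)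
(`PartitionOK s 0 0`, `InternalOK s`), the list of codes of the non-empty blocks `E_{s,t}` IS enumerated: **`exists_blocks`** — some `bl ∈ partsEnum` has
exactly the masks `maskE D s t` of the non-empty blocks, each once. (With `OrderElevenTriangleLabelSound.rowCode_mem_rowsFrom_of` this gives
`rowCode D s ∈ rowsFrom P partsEnum`, assembled in `OrderElevenTriangleNoData`.) Semantic invariant `PInv` of the walker state along the true path;
`addDiffs` never fails on a genuine block (uniqueness of internal differences); the least uncovered element opens the next block. Proofs only; no `sorry`.
-/

namespace Summit.Ventures.DiscreteObjects.PP12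

namespace Triangle12

open Function
open Fin.CommRing -- `Fin 11` as a commutative ring (scoped Mathlib instance): cyclic residue arithmetic

/-! ### bit helpers -/

/-- clearing a set bit by subtraction -/
theorem testBit_sub_two_pow {U y : ℕ} (h : U.testBit y = true) (e : ℕ) : (U - 2 ^ y).testBit e = (U.testBit e && decide (e ≠ y)) := by
  -- split `U = 2^(y+1) a + b`, `b = 2^y + c`, `c < 2^y`
  set a := U / 2 ^ (y + 1)
  set b := U % 2 ^ (y + 1)
  have hU : U = 2 ^ (y + 1) * a + b := (Nat.div_add_mod U (2 ^ (y + 1))).symm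
  have hb : b < 2 ^ (y + 1) := Nat.mod_lt _ (by positivity)
  have hby : b.testBit y = true := by rw [Nat.testBit_mod_two_pow]; simp [h]
  have hbge : 2 ^ y ≤ b := Nat.ge_two_pow_of_testBit hby
  set c := b - 2 ^ y
  have h2 : 2 ^ (y + 1) = 2 ^ y + 2 ^ y := by ring
  have hc : c < 2 ^ y := by omega
  have hbc : b = 2 ^ y + c := by omega
  have hsub : U - 2 ^ y = 2 ^ (y + 1) * a + c := by omega
  rw [hsub, Nat.testBit_two_pow_mul_add a (lt_trans hc (Nat.pow_lt_pow_right (by norm_num) (by omega))), hU,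
    Nat.testBit_two_pow_mul_add a hb]
  by_cases he : e < y + 1
  · simp only [he, if_true]
    by_cases hey : e = y
    · subst hey; simp [Nat.testBit_lt_two_pow hc]
    · rw [hbc, Nat.testBit_two_pow_add_gt (by omega)]; simp [hey]
  · have hey : e ≠ y := by omega
    simp [he, hey]

/-- complement within 11 bits -/
theorem testBit_2047_sub {U : ℕ} (hU : U < 2 ^ 11) (i : ℕ) : (2047 - U).testBit i = (decide (i < 11) && !U.testBit i) := by
  rw [show 2047 - U = 2 ^ 11 - (U + 1) by omega, Nat.testBit_two_pow_sub_succ hU]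

/-- bits of `2046` -/
theorem testBit_2046 (i : ℕ) : Nat.testBit 2046 i = (decide (i < 11) && !decide (i = 0)) := by
  rw [show (2046 : ℕ) = 2 ^ 11 - (1 + 1) by norm_num, Nat.testBit_two_pow_sub_succ (by norm_num)]
  congr 1
  rw [show (1 : ℕ) = 2 ^ 0 from rfl, Nat.testBit_two_pow]
  by_cases h : i = 0
  · simp [h]
  · simp [h, Ne.symm h]

/-- the mask of a code is its low 11 bits -/
theorem code_mask {cur sz : ℕ} (h : cur < 2 ^ 11) : (cur ||| (sz <<< 11)) &&& 2047 = cur := by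
  apply Nat.eq_of_testBit_eq; intro i
  rw [show (2047 : ℕ) = 2 ^ 11 - 1 by norm_num]
  simp only [Nat.testBit_and, Nat.testBit_or, Nat.testBit_shiftLeft, Nat.testBit_two_pow_sub_one]
  by_cases hi : i < 11
  · have : ¬ (i ≥ 11) := by omega
    simp [hi, this]
  · have h2 : 2 ^ 11 ≤ 2 ^ i := Nat.pow_le_pow_right (by norm_num) (not_lt.1 hi)
    simp [hi, Nat.testBit_lt_two_pow (lt_of_lt_of_le h h2)]

/-- what `fz` computes: the first zero bit at or after `11 − c` (or `11`) -/
theorem fz_spec (u : ℕ) : ∀ c, c ≤ 11 →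
    fz u c ≤ 11 ∧ (∀ i, 11 - c ≤ i → i < fz u c → u.testBit i = true) ∧ (fz u c < 11 → u.testBit (fz u c) = false)
  | 0, _ => ⟨by simp [fz], fun i h1 h2 => by simp [fz] at h2; omega, fun h => by simp [fz] at h⟩
  | c + 1, hc => by
    obtain ⟨a1, a2, a3⟩ := fz_spec u c (by omega)
    rw [fz]
    by_cases hb : u.testBit (10 - c) = true
    · rw [if_pos hb]
      refine ⟨a1, fun i hi hlt => ?_, a3⟩
      by_cases hi' : i = 10 - c
      · rw [hi']; exact hb
      · exact a2 i (by omega) hlt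
    · rw [if_neg hb]
      exact ⟨by omega, fun i hi hlt => by omega, fun _ => by simpa using hb⟩

variable (D : TriangleData 11) (s : Fin 11)

/-! ### the semantic invariant of the partition walker -/

/-- the walker state `(U, Dm, cur, blocks)` on the true path: current block `t₀` built up to `top`, closed blocks `CL` -/
structure PInv (t₀ : Fin 11) (top : ℕ) (CL : Finset (Fin 11)) (U Dm cur : ℕ) (blocks : List ℕ) : Prop where
  /-- `top` is an element of the current block -/
  htop : top < 11 ∧ memN D s t₀.val top = true
  /-- `cur` = the current block up to `top` -/
  hcur : ∀ e, cur.testBit e = true ↔ e ≤ top ∧ memN D s t₀.val e = true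
  /-- the current block is not closed -/
  ht₀ : t₀ ∉ CL
  /-- closed codes are blocks of `CL` … -/
  hbl : ∀ b ∈ blocks, ∃ t ∈ CL, b &&& 2047 = maskE D s t.val
  /-- … every block of `CL` is closed and non-empty … -/
  hcl : ∀ t ∈ CL, (∃ b ∈ blocks, b &&& 2047 = maskE D s t.val) ∧ maskE D s t.val ≠ 0
  /-- … once -/
  hnd : (blocks.map (· &&& 2047)).Nodup
  /-- `U` = the uncovered elements of `{1,…,10}` -/
  hU : ∀ e, U.testBit e = true ↔ 1 ≤ e ∧ e < 11 ∧ ¬ ((e ≤ top ∧ memN D s t₀.val e = true) ∨ ∃ t ∈ CL, memN D s t.val e = true)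
  /-- `Dm` = the internal differences of the covered parts of the blocks -/
  hDm : ∀ d, Dm.testBit d = true ↔ ∃ t a a' : Fin 11, a ≠ a' ∧ D.mem s t a = true ∧ D.mem s t a' = true ∧
    ((t = t₀ ∧ a.val ≤ top) ∨ t ∈ CL) ∧ ((t = t₀ ∧ a'.val ≤ top) ∨ t ∈ CL) ∧ (a - a').val = d

/-- the target property of a block list: the non-empty blocks of the orbit `s`, each exactly once -/
def GoodBlocks (bl : List ℕ) : Prop :=
  (∀ b ∈ bl, ∃ t : Fin 11, b &&& 2047 = maskE D s t.val ∧ maskE D s t.val ≠ 0) ∧ (bl.map (· &&& 2047)).Nodup ∧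
    ∀ t : Fin 11, maskE D s t.val ≠ 0 → ∃ b ∈ bl, b &&& 2047 = maskE D s t.val

variable {D s}

/-! ### facts about blocks of data satisfying (K0) -/

section K0
variable (hK0 : D.PartitionOK s (fun _ => 0) 0)
include hK0

/-- no block contains `0` -/
theorem memN_zero (t : Fin 11) : memN D s t.val 0 = false := by
  have h := hK0.1 t
  simp only [add_zero] at h
  rw [← h, ← memN_val]; rfl

/-- a free point lies in one block -/
theorem block_unique {t t' : Fin 11} {e : ℕ} (h1 : memN D s t.val e = true) (h2 : memN D s t'.val e = true) : t = t' := by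
  have he : e < 11 := by by_contra hn; rw [memN_of_ge D s (not_lt.1 hn)] at h1; exact Bool.false_ne_true h1
  let y : Fin 11 := ⟨e, he⟩
  have m1 : D.mem s t (y + 0) = true := by rw [add_zero, ← memN_val]; exact h1
  have m2 : D.mem s t' (y + 0) = true := by rw [add_zero, ← memN_val]; exact h2
  have hy : y ≠ 0 := fun h0 => by
    have := memN_zero hK0 t; rw [show (0 : ℕ) = y.val from congrArg Fin.val h0.symm] at this
    rw [this] at h1; exact Bool.false_ne_true h1
  obtain ⟨w, -, hw⟩ := hK0.2 y hy
  exact (hw t m1).trans (hw t' m2).symm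

/-- every `e ∈ {1,…,10}` lies in some block -/
theorem exists_block {e : ℕ} (h1 : 1 ≤ e) (h2 : e < 11) : ∃ t : Fin 11, memN D s t.val e = true := by
  obtain ⟨t, ht, -⟩ := hK0.2 ⟨e, h2⟩ (fun h => by have := congrArg Fin.val h; simp at this; omega)
  exact ⟨t, by rw [add_zero, ← memN_val] at ht; exact ht⟩

/-- equal non-empty block masks have equal labels -/
theorem label_of_maskE_eq {t t' : Fin 11} (hne : maskE D s t.val ≠ 0) (h : maskE D s t.val = maskE D s t'.val) : t = t' := by
  obtain ⟨i, hi⟩ := Nat.exists_testBit_of_ne_zero hne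
  have h1 : memN D s t.val i = true := by rwa [testBit_maskE] at hi
  have h2 : memN D s t'.val i = true := by rw [h, testBit_maskE] at hi; exact hi
  exact block_unique hK0 h1 h2

end K0

/-- a non-zero block mask has an element -/
theorem exists_mem_of_maskE_ne_zero' (D : TriangleData 11) (s : Fin 11) {t : ℕ} (h : maskE D s t ≠ 0) :
    ∃ e, memN D s t e = true := by
  obtain ⟨i, hi⟩ := Nat.exists_testBit_of_ne_zero h
  exact ⟨i, by rwa [testBit_maskE] at hi⟩

/-- value of a difference in `Fin 11` -/
theorem val_sub11'' (a b : Fin 11) : (a - b).val = (a.val + 11 - b.val) % 11 := by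
  have h := Fin.val_add b (a - b)
  rw [add_sub_cancel] at h
  have := a.isLt; have := b.isLt; have := (a - b).isLt
  omega

/-! ### `addDiffs` succeeds on a genuine block -/

/-- the two new differences of `y` against `e` -/
def nd1 (y e : ℕ) : ℕ := (y + 11 - e) % 11
/-- the two new differences of `y` against `e` -/
def nd2 (y e : ℕ) : ℕ := (e + 11 - y) % 11

/-- semantic description of the accumulated new differences over the elements `< k` of `cur` -/
def NDsem (cur y k nd : ℕ) : Prop :=
  ∀ d, nd.testBit d = true ↔ ∃ e, e < k ∧ cur.testBit e = true ∧ (d = nd1 y e ∨ d = nd2 y e)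

/-- `addDiffs` returns the full set of new differences when they are genuinely new and distinct -/
theorem addDiffs_ok (cur y Dm : ℕ) (Hd : ∀ e, e < 11 → cur.testBit e = true → nd1 y e ≠ nd2 y e)
    (HD : ∀ e, e < 11 → cur.testBit e = true → Dm.testBit (nd1 y e) = false ∧ Dm.testBit (nd2 y e) = false)
    (Hx : ∀ e e', e < 11 → e' < 11 → cur.testBit e = true → cur.testBit e' = true → e ≠ e' →
      nd1 y e ≠ nd1 y e' ∧ nd1 y e ≠ nd2 y e' ∧ nd2 y e ≠ nd1 y e' ∧ nd2 y e ≠ nd2 y e') :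
    ∀ c, c ≤ 11 → ∀ nd, NDsem cur y (11 - c) nd → ∃ nd', addDiffs cur y Dm c nd = some nd' ∧ NDsem cur y 11 nd'
  | 0, _, nd, h => ⟨nd, rfl, h⟩
  | c + 1, hc, nd, h => by
    have he : 11 - (c + 1) < 11 := by omega
    rw [addDiffs]
    by_cases hb : cur.testBit (11 - (c + 1)) = true
    · rw [if_pos hb]
      simp only []
      set e := 11 - (c + 1) with hedef
      have e1 : (y + 11 - e) % 11 = nd1 y e := rfl
      have e2 : (e + 11 - y) % 11 = nd2 y e := rfl
      -- the guard is false
      have hb' : ∀ d, ((1 <<< nd1 y e) ||| (1 <<< nd2 y e)).testBit d = true ↔ d = nd1 y e ∨ d = nd2 y e := fun d => by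
        simp only [Nat.testBit_or, Nat.testBit_shiftLeft, Bool.or_eq_true, Bool.and_eq_true, decide_eq_true_eq,
          Nat.testBit_one_eq_true_iff_self_eq_zero]
        omega
      have g1 : (nd1 y e == nd2 y e) = false := by simpa [beq_eq_false_iff_ne] using Hd e he hb
      have g2 : ((nd &&& ((1 <<< nd1 y e) ||| (1 <<< nd2 y e))) != 0) = false := by
        rw [bne_eq_false_iff_eq]
        apply Nat.eq_of_testBit_eq; intro d
        rw [Nat.zero_testBit, Nat.testBit_and, Bool.and_eq_false_iff]
        by_contra hcon; simp only [not_or, Bool.not_eq_false] at hcon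
        obtain ⟨hn, hbb⟩ := hcon
        obtain ⟨e', he', hce', hd⟩ := (h d).1 hn
        have hne : e ≠ e' := by omega
        obtain ⟨x1, x2, x3, x4⟩ := Hx e e' he (by omega) hb hce' hne
        rcases (hb' d).1 hbb with rfl | rfl <;> rcases hd with hd | hd <;> simp_all
      have g3 : ((Dm &&& ((1 <<< nd1 y e) ||| (1 <<< nd2 y e))) != 0) = false := by
        rw [bne_eq_false_iff_eq]
        apply Nat.eq_of_testBit_eq; intro d
        rw [Nat.zero_testBit, Nat.testBit_and, Bool.and_eq_false_iff]
        by_contra hcon; simp only [not_or, Bool.not_eq_false] at hcon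
        obtain ⟨hn, hbb⟩ := hcon
        obtain ⟨f1, f2⟩ := HD e he hb
        rcases (hb' d).1 hbb with rfl | rfl
        · rw [f1] at hn; exact Bool.false_ne_true hn
        · rw [f2] at hn; exact Bool.false_ne_true hn
      rw [e1, e2, g1, g2, g3]
      simp only [Bool.false_or, Bool.false_eq_true, if_false]
      refine addDiffs_ok cur y Dm Hd HD Hx c (by omega) _ fun d => ?_
      rw [Nat.testBit_or, Bool.or_eq_true, h d, hb']
      constructor
      · rintro (⟨e', he', hc', hd⟩ | hd)
        · exact ⟨e', by omega, hc', hd⟩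
        · exact ⟨e, by omega, hb, hd⟩
      · rintro ⟨e', he', hc', hd⟩
        by_cases hee : e' = e
        · subst hee; exact Or.inr hd
        · exact Or.inl ⟨e', by omega, hc', hd⟩
    · rw [if_neg hb]
      refine addDiffs_ok cur y Dm Hd HD Hx c (by omega) nd fun d => ?_
      rw [h d]
      constructor
      · rintro ⟨e', he', hc', hd⟩; exact ⟨e', by omega, hc', hd⟩
      · rintro ⟨e', he', hc', hd⟩
        refine ⟨e', ?_, hc', hd⟩
        by_contra hn
        have : e' = 11 - (c + 1) := by omega
        rw [this] at hc'; exact hb hc'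

/-! ### helpers for the main induction (`OrderElevenTriangleWalkMain`) -/

/-- uniqueness of internal differences, two-pair form -/
theorem internal_unique (hI : D.InternalOK s) {t u a a' b b' : Fin 11} (ha : D.mem s t a = true) (ha' : D.mem s t a' = true)
    (hb : D.mem s u b = true) (hb' : D.mem s u b' = true) (hne : a ≠ a') (he : a - a' = b - b') : t = u ∧ a = b := by
  obtain ⟨t₁, x, -, -, huniq⟩ := hI (a - a') (sub_ne_zero.2 hne)
  have e1 := huniq t a ha (by rw [sub_sub_cancel]; exact ha')
  have e2 := huniq u b hb (by rw [he, sub_sub_cancel]; exact hb')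
  exact ⟨e1.1.trans e2.1.symm, e1.2.trans e2.2.symm⟩

/-- the uncovered-element count -/
def ucard (U : ℕ) : ℕ := ((Finset.range 11).filter fun e => U.testBit e = true).card

/-- clearing an uncovered element lowers the count -/
theorem ucard_clear {U y : ℕ} (hy : U.testBit y = true) (hy11 : y < 11) : ucard (U - 2 ^ y) + 1 = ucard U := by
  unfold ucard
  have : ((Finset.range 11).filter fun e => (U - 2 ^ y).testBit e = true) =
      ((Finset.range 11).filter fun e => U.testBit e = true).erase y := by
    ext e
    simp only [Finset.mem_filter, Finset.mem_range, Finset.mem_erase, testBit_sub_two_pow hy, Bool.and_eq_true,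
      decide_eq_true_eq]
    tauto
  rw [this, Finset.card_erase_of_mem (by simp [hy, hy11])]
  have : 0 < ((Finset.range 11).filter fun e => U.testBit e = true).card :=
    Finset.card_pos.2 ⟨y, by simp [hy, hy11]⟩
  omega

/-- the state's `U` has no bits `≥ 11` -/
theorem U_lt {t₀ : Fin 11} {top : ℕ} {CL : Finset (Fin 11)} {U Dm cur : ℕ} {blocks : List ℕ}
    (h : PInv D s t₀ top CL U Dm cur blocks) : U < 2 ^ 11 :=
  Nat.lt_pow_two_of_testBit _ fun i hi => by
    by_contra hc
    have := ((h.hU i).1 (by simpa using hc)).2.1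
    omega

/-- the state's `cur` has no bits `≥ 11` -/
theorem cur_lt {t₀ : Fin 11} {top : ℕ} {CL : Finset (Fin 11)} {U Dm cur : ℕ} {blocks : List ℕ}
    (h : PInv D s t₀ top CL U Dm cur blocks) : cur < 2 ^ 11 :=
  Nat.lt_pow_two_of_testBit _ fun i hi => by
    by_contra hc
    have := ((h.hcur i).1 (by simpa using hc)).1
    have := h.htop.1
    omega

/-- membership in `extLoop` through the branch of one candidate `y` -/
theorem mem_extLoop {K : ℕ → ℕ → ℕ → ℕ → ℕ → List (List ℕ)} {U Dm cur sz y nd : ℕ} (hy : y < 11)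
    (hU : U.testBit y = true) (hadd : addDiffs cur y Dm 11 0 = some nd) {x : List ℕ}
    (hx : x ∈ K (U - (1 <<< y)) (Dm ||| nd) (cur ||| (1 <<< y)) (sz + 1) y) :
    ∀ c, c ≤ 11 → 11 - c ≤ y → x ∈ extLoop K U Dm cur sz c
  | 0, _, h => by omega
  | c + 1, hc, h => by
    rw [extLoop, List.mem_append]
    by_cases hyc : 10 - c = y
    · left; rw [hyc, hU]; simpa [hadd] using hx
    · right; exact mem_extLoop hy hU hadd hx c (by omega) (by omega)

/-- value of `⟨a⟩ - ⟨b⟩` in `Fin 11` -/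
theorem val_mk_sub {a b : ℕ} (ha : a < 11) (hb : b < 11) : ((⟨a, ha⟩ : Fin 11) - ⟨b, hb⟩).val = (a + 11 - b) % 11 :=
  val_sub11'' _ _

end Triangle12

end Summit.Ventures.DiscreteObjects.PP12
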